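import Literature.AlgebraicGeometry.Hu2025.Statements.S01S09Interface.R110eGammaOfMatroid
import Literature.AlgebraicGeometry.Hu2025.Proofs.S01S09Interface.GammaQuadHuMatroid
import Literature.AlgebraicGeometry.Hu2025.Proofs.S07GammaSchemes.GammaQuadDef71Bridge
import Literature.AlgebraicGeometry.Hu2025.Proofs.S03Pluecker.GammaQuadCellDomain
import Mathlib.AlgebraicGeometry.AffineSpace
import HarnessLib

/-!
# Hu 2022 p.131 l.40–41 (LITERAL typed reading, row 110 e) — an INHABITANT `S_quad_lit : Hu22Setup ℚ 9 d_quad` with `X = cell`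
# INTEGRAL and `Z_{Γ_d}` NOT integral (joint J1 / GAP-LEDGER-HU row HU-R01 — OURS; nothing of the sources asserted)

**HONEST FRAMING (D-0012/D-0089).** [Hu2025]/[Hu2022] are unrefereed preprints under adjudication; nothing of them is asserted. This is
the LITERAL-record variant (imports row 110 file e only) of `GammaQuadHu22Setup.lean` (which needs file f for the OURS sibling record
`Hu22Setup_ours`): for 𝔽 = ℚ, n = 9, M = quadHuMatroid (the realised family of the complete quadrilateral) it builds
`S_quad_lit : Hu22Setup ℚ 9 quadHuMatroid` with `X := cell := Spec((GammaSchemeRing 𝓕_m Γ_d)[1/∏_{u∉Γ_d} x̄_u])` (integral), `r := 0`,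
`U := ⊤`, the open immersion `Spec` of the localisation map (image = the Prop-9.1 locus, `range_cellToGammaQ`), and shows
`¬ Hu22P131L40 S_quad_lit` because `Z_{Γ_d} = gammaSpec (𝓕_m) Γ_d` is NOT integral. Decls live in the sub-namespace `Lit` to stay
disjoint from the f-variant. AI proof is weaker than expert review.
-/

noncomputable section

namespace Literature.AlgebraicGeometry.Hu2025.Statements.S01S09Interface

namespace Lit

open _root_.CategoryTheory _root_.AlgebraicGeometry S03Pluecker S07GammaSchemes S08MainTheorem

/-- **`Γ_d ∩ Var_𝐔` of the realised quadrilateral family IS `Γ_quad`**: `GammaOfMatroidVar quadHuMatroid = quadGammaVar`.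
[cite: Hu2025, Prop. 9.1 / (9.3) «Γ := Γ_d» (chunk p0072 l.71–80; PDF p.160); joint J1 = GAP-LEDGER-HU row HU-R01 (unrefereed preprint arXiv:2507.21400v1 under adjudication, D-0012/D-0089 — kernel support on OUR typed carriers of rows 101/109/110; nothing of the source asserted)] -/
theorem gammaOfMatroidVar_quad : GammaOfMatroidVar quadHuMatroid = quadGammaVar := by
  ext x
  rw [GammaOfMatroidVar, Set.mem_setOf_eq, vertexMem_quadHuMatroid_iff (Finset.mem_erase.mp x.2).2, not_not]
  rfl

/-- `Γ'` := row 110's `Γ_d ∩ Var_𝐔` for `d_quad` (abbreviation).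
[cite: Hu2025, Prop. 9.1 (Gr_d, Γ_d) p.160 / Def. 7.1 (Z_Γ) p.128; [Hu22] p.131 l.40–41 (the J1 inference); joint J1 = GAP-LEDGER-HU row HU-R01 (unrefereed preprints arXiv:2507.21400v1 / arXiv:2203.03842v4 under adjudication, D-0012/D-0089 — kernel statement about OUR typed records of rows 101/109/110; nothing of the sources asserted)] -/
abbrev Γq : Set (plVar 9) := GammaOfMatroidVar quadHuMatroid

/-- The Γ-scheme ideal of `Γ'` is row 101's `gammaChartIdeal` of the quadrilateral.
[cite: Hu2025, Def. 7.1 (I_{℘,Γ}) p.128; joint J1 = GAP-LEDGER-HU row HU-R01 (unrefereed preprint arXiv:2507.21400v1 under adjudication, D-0012/D-0089 — kernel support on OUR typed carriers of rows 101/109/110; nothing of the source asserted)] -/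
theorem gammaWpIdeal_Γq : gammaWpIdeal (primaryFamily 9 ℚ) Γq = gammaChartIdeal ℚ 9 quadGamma := by
  rw [Γq, gammaOfMatroidVar_quad]; exact gammaWpIdeal_quad_eq ℚ

/-- `GammaSchemeRing (𝓕_m) Γ' ≃+* Rq ℚ`.
[cite: Hu2025, Prop. 9.1 (Gr_d, Γ_d) p.160 / Def. 7.1 (Z_Γ) p.128; [Hu22] p.131 l.40–41 (the J1 inference); joint J1 = GAP-LEDGER-HU row HU-R01 (unrefereed preprints arXiv:2507.21400v1 / arXiv:2203.03842v4 under adjudication, D-0012/D-0089 — kernel statement about OUR typed records of rows 101/109/110; nothing of the sources asserted)] -/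
def ringEquivRq : GammaSchemeRing (primaryFamily 9 ℚ) Γq ≃+* QuadCell.Rq ℚ := Ideal.quotEquivOfEq gammaWpIdeal_Γq

/-- **`Z_{Γ_d}` is NOT integral at ring level**: `GammaSchemeRing (𝓕_m) Γ'` is not a domain.
[cite: Hu2025, Def. 7.1 (Z_Γ) p.128; [Hu22] p.131 l.40–41; joint J1 = GAP-LEDGER-HU row HU-R01 (unrefereed preprint arXiv:2507.21400v1 under adjudication, D-0012/D-0089 — kernel support on OUR typed carriers of rows 101/109/110; nothing of the source asserted)] -/
theorem not_isDomain_gammaSchemeRing_Γq : ¬ IsDomain (GammaSchemeRing (primaryFamily 9 ℚ) Γq) := by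
  intro h
  exact not_isDomain_gammaChart_quad_nine ℚ ringEquivRq.symm.toMulEquiv.isDomain

/-- the product of the non-`Γ` chart coordinates in `GammaSchemeRing (𝓕_m) Γ'`.
[cite: Hu2025, Prop. 9.1 (Gr_d, Γ_d) p.160 / Def. 7.1 (Z_Γ) p.128; [Hu22] p.131 l.40–41 (the J1 inference); joint J1 = GAP-LEDGER-HU row HU-R01 (unrefereed preprints arXiv:2507.21400v1 / arXiv:2203.03842v4 under adjudication, D-0012/D-0089 — kernel statement about OUR typed records of rows 101/109/110; nothing of the sources asserted)] -/
def denΓq : GammaSchemeRing (primaryFamily 9 ℚ) Γq := Ideal.Quotient.mk _ (QuadCell.hprod ℚ)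

/-- The ring isomorphism sends the product of the non-Γ coordinates to `hq`.
[cite: Hu2025, Prop. 9.1 (Gr_d, Γ_d) p.160 / Def. 7.1 (Z_Γ) p.128; [Hu22] p.131 l.40–41 (the J1 inference); joint J1 = GAP-LEDGER-HU row HU-R01 (unrefereed preprints arXiv:2507.21400v1 / arXiv:2203.03842v4 under adjudication, D-0012/D-0089 — kernel statement about OUR typed records of rows 101/109/110; nothing of the sources asserted)] -/
theorem ringEquivRq_den : ringEquivRq denΓq = QuadCell.hq ℚ := by
  rw [denΓq, ringEquivRq, Ideal.quotEquivOfEq_mk]; rfl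

/-- **The cell ring** `(GammaSchemeRing (𝓕_m) Γ')[1/∏_{u ∉ Γ} x̄_u]`. OURS.
[cite: Hu2025, Prop. 9.1 (Gr_d, Γ_d) p.160 / Def. 7.1 (Z_Γ) p.128; [Hu22] p.131 l.40–41 (the J1 inference); joint J1 = GAP-LEDGER-HU row HU-R01 (unrefereed preprints arXiv:2507.21400v1 / arXiv:2203.03842v4 under adjudication, D-0012/D-0089 — kernel statement about OUR typed records of rows 101/109/110; nothing of the sources asserted)] -/
abbrev CellRing : Type := Localization.Away denΓq

/-- **The cell ring is a domain** (W9 transported).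
[cite: Hu2025, Prop. 9.1 (Gr_d, Γ_d) p.160 / Def. 7.1 (Z_Γ) p.128; [Hu22] p.131 l.40–41 (the J1 inference); joint J1 = GAP-LEDGER-HU row HU-R01 (unrefereed preprints arXiv:2507.21400v1 / arXiv:2203.03842v4 under adjudication, D-0012/D-0089 — kernel statement about OUR typed records of rows 101/109/110; nothing of the sources asserted)] -/
instance isDomain_cellRing : IsDomain CellRing := by
  haveI : IsDomain (QuadCell.Rh ℚ) := QuadCell.isDomain_awayGammaChart_quad ℚ
  have H : (Submonoid.powers denΓq).map ringEquivRq.toMonoidHom = Submonoid.powers (QuadCell.hq ℚ) := by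
    rw [Submonoid.map_powers]; exact congrArg Submonoid.powers ringEquivRq_den
  exact (IsLocalization.ringEquivOfRingEquiv CellRing (QuadCell.Rh ℚ) ringEquivRq H).toMulEquiv.isDomain

/-- **The cell as a scheme.** OURS.
[cite: Hu2025, Prop. 9.1 (Gr_d, Γ_d) p.160 / Def. 7.1 (Z_Γ) p.128; [Hu22] p.131 l.40–41 (the J1 inference); joint J1 = GAP-LEDGER-HU row HU-R01 (unrefereed preprints arXiv:2507.21400v1 / arXiv:2203.03842v4 under adjudication, D-0012/D-0089 — kernel statement about OUR typed records of rows 101/109/110; nothing of the sources asserted)] -/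
def cellScheme : Scheme.{0} := Spec (CommRingCat.of CellRing)

/-- Instance (integrality / open immersion of the cell, OURS construction).
[cite: Hu2025, Prop. 9.1 (Gr_d, Γ_d) p.160 / Def. 7.1 (Z_Γ) p.128; [Hu22] p.131 l.40–41 (the J1 inference); joint J1 = GAP-LEDGER-HU row HU-R01 (unrefereed preprints arXiv:2507.21400v1 / arXiv:2203.03842v4 under adjudication, D-0012/D-0089 — kernel statement about OUR typed records of rows 101/109/110; nothing of the sources asserted)] -/
instance : IsIntegral cellScheme := by unfold cellScheme; infer_instance

/-- **The open immersion `cell ↪ Z_{Γ_d}`** = `Spec` of the localisation map. OURS.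
[cite: Hu2025, Prop. 9.1 (Gr_d, Γ_d) p.160 / Def. 7.1 (Z_Γ) p.128; [Hu22] p.131 l.40–41 (the J1 inference); joint J1 = GAP-LEDGER-HU row HU-R01 (unrefereed preprints arXiv:2507.21400v1 / arXiv:2203.03842v4 under adjudication, D-0012/D-0089 — kernel statement about OUR typed records of rows 101/109/110; nothing of the sources asserted)] -/
def cellToGammaQ : cellScheme ⟶ gammaSpec (primaryFamily 9 ℚ) Γq :=
  Spec.map (CommRingCat.ofHom (algebraMap (GammaSchemeRing (primaryFamily 9 ℚ) Γq) CellRing))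

/-- Instance (integrality / open immersion of the cell, OURS construction).
[cite: Hu2025, Prop. 9.1 (Gr_d, Γ_d) p.160 / Def. 7.1 (Z_Γ) p.128; [Hu22] p.131 l.40–41 (the J1 inference); joint J1 = GAP-LEDGER-HU row HU-R01 (unrefereed preprints arXiv:2507.21400v1 / arXiv:2203.03842v4 under adjudication, D-0012/D-0089 — kernel statement about OUR typed records of rows 101/109/110; nothing of the sources asserted)] -/
instance : IsOpenImmersion cellToGammaQ := by
  unfold cellToGammaQ
  exact IsOpenImmersion.of_isLocalization denΓq

/-- image of the open immersion = the basic open of the product = «x̄_u ∉ 𝔭 for all u ∉ Γ_d».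
[cite: Hu2025, Prop. 9.1 (Gr_d, Γ_d) p.160 / Def. 7.1 (Z_Γ) p.128; [Hu22] p.131 l.40–41 (the J1 inference); joint J1 = GAP-LEDGER-HU row HU-R01 (unrefereed preprints arXiv:2507.21400v1 / arXiv:2203.03842v4 under adjudication, D-0012/D-0089 — kernel statement about OUR typed records of rows 101/109/110; nothing of the sources asserted)] -/
theorem range_cellToGammaQ :
    Set.range cellToGammaQ.base =
      {x : PrimeSpectrum (GammaSchemeRing (primaryFamily 9 ℚ) Γq) |
        ∀ u : plVar 9, u ∉ Γq → (Ideal.Quotient.mk (gammaWpIdeal (primaryFamily 9 ℚ) Γq) (MvPolynomial.X u)) ∉ x.asIdeal} := by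
  -- the underlying map of `Spec.map` is `PrimeSpectrum.comap`
  have hrange : Set.range cellToGammaQ.base =
      Set.range (PrimeSpectrum.comap (algebraMap (GammaSchemeRing (primaryFamily 9 ℚ) Γq) CellRing)) := by
    rw [cellToGammaQ, Spec.map_base]; rfl
  rw [hrange, PrimeSpectrum.localization_away_comap_range CellRing denΓq]
  ext x
  rw [SetLike.mem_coe, PrimeSpectrum.mem_basicOpen, Set.mem_setOf_eq, denΓq, QuadCell.hprod, map_prod]
  haveI := x.isPrime
  rw [Ideal.IsPrime.prod_mem_iff, not_exists]
  constructor
  · intro h u hu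
    have hu' : u.1 ∈ QuadCell.offGamma := by
      refine Finset.mem_filter.mpr ⟨u.2, fun hΓ => hu ?_⟩
      rw [Γq, gammaOfMatroidVar_quad]
      exact (mem_quadGammaFin_iff u.1).mp hΓ
    have := h u.1
    rw [not_and] at this
    have hx := this hu'
    rwa [xbar_of_mem ℚ u.2] at hx
  · intro h v
    rw [not_and]
    intro hv
    have hv1 : v ∈ plVarSet 9 := (Finset.mem_filter.mp hv).1
    have hv2 : v ∉ quadGammaFin := (Finset.mem_filter.mp hv).2
    have hΓ : (⟨v, hv1⟩ : plVar 9) ∉ Γq := by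
      rw [Γq, gammaOfMatroidVar_quad]
      exact fun hh => hv2 ((mem_quadGammaFin_iff v).mpr hh)
    have := h ⟨v, hv1⟩ hΓ
    rwa [xbar_of_mem ℚ hv1]

/-- **THE INHABITANT (literal record)** `S_quad_lit : Hu22Setup ℚ 9 quadHuMatroid` with `X = cell`. OURS.
[cite: Hu2025, (9.2)/(9.3) and [Hu22] p.131 l.29–41 (the set-up of the J1 inference); joint J1 = GAP-LEDGER-HU row HU-R01 (unrefereed preprints arXiv:2507.21400v1 / arXiv:2203.03842v4 under adjudication, D-0012/D-0089 — kernel statement about OUR typed records of rows 101/109/110; nothing of the sources asserted)] -/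
def S_quad_lit : Hu22Setup ℚ 9 quadHuMatroid where
  X := cellScheme
  r := 0
  U := ⊤
  U_onto := by
    haveI : IsIso (⊤ : (𝔸(Fin 0; cellScheme)).Opens).ι :=
      inferInstanceAs (IsIso (𝔸(Fin 0; cellScheme)).topIso.hom)
    infer_instance
  cell := cellScheme
  quot := inv (𝔸(Fin 0; cellScheme) ↘ cellScheme) ≫ (𝔸(Fin 0; cellScheme)).topIso.inv
  quot_surjective := by infer_instance
  m_mem := vertexMem_quadHuMatroid_mTri
  cellToGamma := cellToGammaQ
  cellToGamma_isOpenImmersion := by infer_instance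

/-- **`Z_{Γ_d}` is not an integral scheme.**
[cite: Hu2025, Prop. 9.1 (Gr_d, Γ_d) p.160 / Def. 7.1 (Z_Γ) p.128; [Hu22] p.131 l.40–41 (the J1 inference); joint J1 = GAP-LEDGER-HU row HU-R01 (unrefereed preprints arXiv:2507.21400v1 / arXiv:2203.03842v4 under adjudication, D-0012/D-0089 — kernel statement about OUR typed records of rows 101/109/110; nothing of the sources asserted)] -/
theorem not_isIntegral_gammaSpec_Γq : ¬ IsIntegral (gammaSpec (primaryFamily 9 ℚ) Γq) := by
  intro h
  exact not_isDomain_gammaSchemeRing_Γq ((affine_isIntegral_iff _).mp h)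

/-- **¬ Hu22P131L40 S_quad_lit** — the LITERAL typed reading of [Hu22] p.131 l.40–41 («As X is integral, one sees that Z_Γ is
integral») fails for this inhabitant: its `X` (= the cell) is integral, `Z_{Γ_d}` is not. (The image of `cellToGamma` is moreover the
Prop-9.1 locus — `range_cellToGammaQ` — so the same data serve the OURS sibling record once row 110 f lands.)
[cite: Hu2025, [Hu22] p.131 l.40–41; joint J1 = GAP-LEDGER-HU row HU-R01 (unrefereed preprints under adjudication, D-0012/D-0089 — kernel statement about OUR typed records; nothing of the sources asserted)] -/
theorem not_Hu22P131L40_quad_lit : ¬ Hu22P131L40 S_quad_lit := fun h =>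
  not_isIntegral_gammaSpec_Γq (h (inferInstanceAs (IsIntegral cellScheme)))

end Lit

end Literature.AlgebraicGeometry.Hu2025.Statements.S01S09Interface

end
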